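import Literature.Algebra.Lie.LefschetzModulePrimitive
import HarnessLib

/-!
# A tensor factor of a Lefschetz module is a Lefschetz module (converse of "closed under tensor products",
# Looijenga–Lunts 1997, §1)

Topic `Literature/Algebra/Lie` (namespace `Literature.Algebra.Lie`).  A theorems-only rider on `LefschetzModule.lean`
§8 (A1-88/A1-90, `HasLefschetzProperty.tensor`: if `e` on `(M, h)` and `e'` on `(N, h')` have the Lefschetz property
then so does `e ⊗ 1 + 1 ⊗ e'` on `(M ⊗ N, h ⊗ 1 + 1 ⊗ h')`).  Here the CONVERSE in the first factor:
**if `e ⊗ 1 + 1 ⊗ e'` has the Lefschetz property on `M ⊗ N`, `e'` has it on `N`, and `N ≠ 0`, then `e` has it on `M`**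
(`HasLefschetzProperty.of_tensor`).  In terms of `𝔰𝔩₂`-modules: if `M ⊗ N` and `N ≠ 0` are `𝔰𝔩₂`-modules compatibly
with `e_M ⊗ 1 + 1 ⊗ e_N`, `h_M ⊗ 1 + 1 ⊗ h_N`, then `(e_M, h_M)` integrates to an `𝔰𝔩₂`-module structure on `M`
(by (1.1), `HasLefschetzProperty.isSl2Triple_dual` in `LefschetzModule.lean`).  Use (cell `hodge-kum4`, lane (V), V0): for Beauville's Galois
cover `Θ : A × Kⁿ(A) → A^[n+1]` one has `H*(A^[n+1]) ≅ H*(A) ⊗ H*(Kⁿ(A))^{A[n+1]}` compatibly with the Lefschetz and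
degree operators, so the hard Lefschetz property of a class `ℓ` on `A^[n+1]` forces that of its restriction to the
abelian surface `A` along an orbit — with no ampleness hypothesis.

No definition, no named fact, no `sorry`; finite dimension over a field of characteristic `0`.

## Sources

* E. Looijenga, V. A. Lunts, *A Lie algebra attached to a projective variety*, Invent. Math. **129** (1997), §1 p. 4
  L62–L63, L70–L76 (held `paper:arxiv-alg-geom_9604014`): "The collection of Lefschetz modules is closed under direct
  sums, tensor products and taking duals", "`e_{(a',a'')}(m' ⊗ m'') = e_{a'} m' ⊗ m'' + m' ⊗ e_{a''} m''`"; (1.1)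
  p. 4 L1–L2 (the Lefschetz property: "`e^k` maps `M_{-k}` isomorphically onto `M_k`").
* E. Cattani, App. A of *Hodge Theory* (Math. Notes 49, 2014), Def. A.2.5 (HL property) and Example A.3.1 / (A.3.3)
  (strings `N₊(e_j) = μ_j e_{j+2}`).

No proof of the converse is printed (it is usually read off the Clebsch–Gordan rule); the proof below is elementary.

## Proof

Write `E = e ⊗ 1 + 1 ⊗ e'`, `H = h ⊗ 1 + 1 ⊗ h'`, `d` = the depth of `N` (`N_{±d} ≠ 0`, `N_j = 0` for `|j| > d`).
* INJECTIVITY of `e^k` on `M_{-k}`: pick `0 ≠ n₀ ∈ N_{-d}` (then `e'^{d+1} n₀ ∈ N_{d+2} = 0`).  For `x ∈ M_{-k}` with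
  `e^k x = 0`, `E^{k+d}(x ⊗ n₀) = Σᵢ C(k+d, i) eⁱx ⊗ e'^{k+d-i} n₀ = 0` (for `i ≥ k` the first factor vanishes, for
  `i < k` the second), and `x ⊗ n₀ ∈ (M ⊗ N)_{-(k+d)}`, so `x ⊗ n₀ = 0` by the Lefschetz property of `E`, so `x = 0`.
* SURJECTIVITY of `e^k : M_{-k} → M_k`: pick `0 ≠ n₁ ∈ N_d` and a functional `φ` on `N` with `φ(n₁) = 1` vanishing on
  every `N_j`, `j ≠ d`; let `Φ = id ⊗ φ : M ⊗ N → M`.  For `y ∈ M_k`, `y ⊗ n₁ = E^{k+d} u` with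
  `u ∈ (M ⊗ N)_{-(k+d)}`, a sum of `x ⊗ n` with `x ∈ M_a`, `n ∈ N_j`, `a + j = -(k+d)`; then
  `y = Φ(E^{k+d} u) = Σ C(k+d,i) φ(e'^{k+d-i} n) eⁱ x`, and `φ(e'^{k+d-i} n) ≠ 0` forces `j + 2(k+d-i) = d`, whence
  `i ≥ k` (else `j < -d`, `n = 0`) and `a + 2(i-k) = -k`, so `eⁱ x = e^k (e^{i-k} x) ∈ e^k M_{-k}`.

## Contents (all proved)

* `degreeSpace_rTensor_add_lTensor_le_span` — `(M ⊗ N)_m` is spanned by the `x ⊗ n`, `x ∈ M_a`, `n ∈ N_j`, `a + j = m`;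
* `rTensor_add_lTensor_pow_tmul` — the binomial formula for `E^m (x ⊗ n)`;
* `HasLefschetzProperty.injOn_of_tensor`, `HasLefschetzProperty.surjOn_of_tensor`, **`HasLefschetzProperty.of_tensor`**.
-/

noncomputable section

namespace Literature.Algebra.Lie

open Module Function Set
open scoped TensorProduct

-- No Lie bracket is needed in this file (only `HasLefschetzProperty`); users obtain the `𝔰𝔩₂`-partner of `e` from
-- `HasLefschetzProperty.exists_isSl2Triple` / `.isSl2Triple_dual` in `LefschetzModule.lean`.

variable {K : Type*} [Field K] [CharZero K] {M N : Type*} [AddCommGroup M] [Module K M] [FiniteDimensional K M]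
  [AddCommGroup N] [Module K N] [FiniteDimensional K N] {h e : Module.End K M} {h' e' : Module.End K N}

/-! ### Homogeneous pure tensors span the degree parts of `M ⊗ N` -/

omit [CharZero K] [FiniteDimensional K M] [FiniteDimensional K N] in
/-- A general lattice fact for gradings: if submodules `S m ≤ E m` with `(E m)` independent and `⨆ S m = ⊤`, then
`S m = E m`. [cite: LooijengaLunts1997, §1 (1.1) p. 3 L106–L111 ("a ℤ-graded K-vector space")] -/
theorem eq_of_le_of_iSupIndep_of_iSup_eq_top {ι : Type*} {V : Type*} [AddCommGroup V] [Module K V]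
    {S E : ι → Submodule K V} (hle : ∀ m, S m ≤ E m) (hind : iSupIndep E) (htop : ⨆ m, S m = ⊤) (m : ι) :
    S m = E m := by
  classical
  refine le_antisymm (hle m) fun v hv ↦ ?_
  have hv' : v ∈ ⨆ m, S m := by rw [htop]; exact Submodule.mem_top
  rw [iSup_split_single S m, Submodule.mem_sup] at hv'
  obtain ⟨s, hs, r, hr, rfl⟩ := hv'
  have hr' : r ∈ ⨆ (i) (_ : i ≠ m), E i := by
    refine (iSup_mono fun i ↦ iSup_mono fun _ ↦ hle i) hr
  have hrE : r ∈ E m := by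
    have := (E m).sub_mem hv (hle m hs)
    rwa [add_sub_cancel_left] at this
  have hdis : Disjoint (E m) (⨆ (i) (_ : i ≠ m), E i) := by
    have := hind.disjoint_biSup (y := {i | i ≠ m}) (x := m) (by simp)
    simpa using this
  have hr0 : r = 0 := by
    have := (Submodule.disjoint_def.1 hdis) r hrE hr'
    exact this
  rw [hr0, add_zero]
  exact hs

omit [CharZero K] [FiniteDimensional K M] [FiniteDimensional K N] in
/-- **`(M ⊗ N)_m` is spanned by the homogeneous pure tensors `x ⊗ n`, `x ∈ M_a`, `n ∈ N_j`, `a + j = m`** (for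
`ℤ`-graded `M`, `N` over a field of characteristic `0`: `M ⊗ N = ⊕_{a,j} M_a ⊗ N_j` and `M_a ⊗ N_j ⊆ (M ⊗ N)_{a+j}`).
[cite: LooijengaLunts1997, §1 (1.1) p. 4 L62–L63, L70–L72] -/
theorem degreeSpace_rTensor_add_lTensor_le_span [CharZero K] (hgr : IsZGrading h) (hgr' : IsZGrading h') (m : ℤ) :
    degreeSpace (h.rTensor N + h'.lTensor M) m ≤
      Submodule.span K {v | ∃ (a j : ℤ) (x : M) (n : N),
        a + j = m ∧ x ∈ degreeSpace h a ∧ n ∈ degreeSpace h' j ∧ v = x ⊗ₜ[K] n} := by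
  set S : ℤ → Submodule K (M ⊗[K] N) := fun m ↦ Submodule.span K {v | ∃ (a j : ℤ) (x : M) (n : N),
    a + j = m ∧ x ∈ degreeSpace h a ∧ n ∈ degreeSpace h' j ∧ v = x ⊗ₜ[K] n} with hSdef
  have hle : ∀ m, S m ≤ degreeSpace (h.rTensor N + h'.lTensor M) m := by
    intro m
    refine Submodule.span_le.2 ?_
    rintro _ ⟨a, j, x, n, hm, hx, hn, rfl⟩
    rw [← hm]
    exact tmul_mem_degreeSpace hx hn
  have htop : ⨆ m, S m = ⊤ := by
    rw [eq_top_iff]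
    rintro z -
    induction z using TensorProduct.induction_on with
    | zero => exact Submodule.zero_mem _
    | add x y hx hy => exact Submodule.add_mem _ hx hy
    | tmul x y =>
      have hx : x ∈ ⨆ k : ℤ, degreeSpace h k := by rw [hgr]; exact Submodule.mem_top
      have hy : y ∈ ⨆ k : ℤ, degreeSpace h' k := by rw [hgr']; exact Submodule.mem_top
      refine Submodule.iSup_induction _ (motive := fun x ↦ x ⊗ₜ[K] y ∈ ⨆ k : ℤ, S k) hx (fun i x hx ↦ ?_)
        (by rw [TensorProduct.zero_tmul]; exact Submodule.zero_mem _)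
        (fun x x' hx hx' ↦ by rw [TensorProduct.add_tmul]; exact Submodule.add_mem _ hx hx')
      exact Submodule.iSup_induction _ (motive := fun y ↦ x ⊗ₜ[K] y ∈ ⨆ k : ℤ, S k) hy
        (fun j y hy ↦ Submodule.mem_iSup_of_mem (i + j) (Submodule.subset_span ⟨i, j, x, y, rfl, hx, hy, rfl⟩))
        (by rw [TensorProduct.tmul_zero]; exact Submodule.zero_mem _)
        (fun y y' hy hy' ↦ by rw [TensorProduct.tmul_add]; exact Submodule.add_mem _ hy hy')
  have hind : iSupIndep fun m : ℤ ↦ degreeSpace (h.rTensor N + h'.lTensor M) m :=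
    (HasLefschetzProperty.isInternal_degreeSpace (isZGrading_rTensor_add_lTensor hgr hgr')).submodule_iSupIndep
  exact (eq_of_le_of_iSupIndep_of_iSup_eq_top hle hind htop m).ge

/-! ### The binomial formula for `(e ⊗ 1 + 1 ⊗ e')^m` -/

omit [CharZero K] [FiniteDimensional K M] [FiniteDimensional K N] in
/-- **`(e ⊗ 1 + 1 ⊗ e')^m (x ⊗ n) = Σ_{i ≤ m} C(m, i) · eⁱ x ⊗ e'^{m-i} n`** (`e ⊗ 1` and `1 ⊗ e'` commute).
[cite: LooijengaLunts1997, §1 (1.1) p. 4 L70–L72] -/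
theorem rTensor_add_lTensor_pow_tmul (e : Module.End K M) (e' : Module.End K N) (m : ℕ) (x : M) (n : N) :
    ((e.rTensor N + e'.lTensor M) ^ m) (x ⊗ₜ[K] n) =
      ∑ i ∈ Finset.range (m + 1), (m.choose i : K) • ((e ^ i) x ⊗ₜ[K] (e' ^ (m - i)) n) := by
  have hc : Commute (e.rTensor N) (e'.lTensor M) := by
    change e.rTensor N * e'.lTensor M = e'.lTensor M * e.rTensor N
    rw [Module.End.mul_eq_comp, Module.End.mul_eq_comp, LinearMap.rTensor_comp_lTensor, LinearMap.lTensor_comp_rTensor]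
  rw [hc.add_pow, LinearMap.sum_apply]
  refine Finset.sum_congr rfl fun i _ ↦ ?_
  rw [LinearMap.rTensor_pow, LinearMap.lTensor_pow, Module.End.mul_apply, Module.End.mul_apply,
    Module.End.natCast_apply, map_nsmul, map_nsmul, LinearMap.lTensor_tmul, LinearMap.rTensor_tmul,
    Nat.cast_smul_eq_nsmul]

/-! ### Injectivity of `e^k` on `M_{-k}` -/

omit [CharZero K] [FiniteDimensional K M] [FiniteDimensional K N] in
/-- `x ⊗ n = 0` with `n ≠ 0` forces `x = 0` (vector spaces). [cite: LooijengaLunts1997, §1 (1.1) p. 4 L73–L76 ("if both factors are nonzero")] -/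
theorem eq_zero_of_tmul_eq_zero {x : M} {n : N} (hn : n ≠ 0) (hxn : x ⊗ₜ[K] n = 0) : x = 0 := by
  obtain ⟨ψ, hψ⟩ := Module.Projective.exists_dual_ne_zero K hn
  have h1 : (TensorProduct.rid K M) ((ψ.lTensor M) (x ⊗ₜ[K] n)) = ψ n • x := by
    rw [LinearMap.lTensor_tmul, TensorProduct.rid_tmul]
  rw [hxn, map_zero, map_zero] at h1
  exact (smul_eq_zero.1 h1.symm).resolve_left hψ

omit [FiniteDimensional K M] in
/-- **Injectivity.**  If `E = e ⊗ 1 + 1 ⊗ e'` has the Lefschetz property on `(M ⊗ N, h ⊗ 1 + 1 ⊗ h')`, `e'` has it on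
`(N, h')` and `N ≠ 0`, then `e^k` is injective on `M_{-k}` (`e` of degree `2`): test against a bottom vector
`0 ≠ n₀ ∈ N_{-d}`, `d` the depth of `N`. [cite: LooijengaLunts1997, §1 (1.1) p. 4 L1–L2, L62–L63] -/
theorem HasLefschetzProperty.injOn_of_tensor [Nontrivial N] (hgr' : IsZGrading h') (L' : HasLefschetzProperty h' e')
    (LT : HasLefschetzProperty (h.rTensor N + h'.lTensor M) (e.rTensor N + e'.lTensor M)) (k : ℕ) {x : M}
    (hx : x ∈ degreeSpace h (-(k : ℤ))) (h0 : (e ^ k) x = 0) : x = 0 := by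
  -- a bottom vector of `N`
  set d := depth h' with hd
  obtain ⟨n₀, hn₀, hn₀0⟩ := Submodule.exists_mem_ne_zero_of_ne_bot (L'.degreeSpace_neg_depth_ne_bot hgr')
  have hkill : ∀ j : ℕ, d + 1 ≤ j → (e' ^ j) n₀ = 0 := by
    intro j hj
    have h1 := pow_apply_mem_degreeSpace L'.mapsTo hn₀ j
    have h2 : (-(depth h' : ℤ) + 2 * (j : ℤ)) = ((2 * j - d : ℕ) : ℤ) := by rw [← hd]; omega
    rw [h2, L'.degreeSpace_eq_bot_of_depth_lt (by omega), Submodule.mem_bot] at h1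
    exact h1
  -- `E^{k+d} (x ⊗ n₀) = 0`
  have hE : ((e.rTensor N + e'.lTensor M) ^ (k + d)) (x ⊗ₜ[K] n₀) = 0 := by
    rw [rTensor_add_lTensor_pow_tmul]
    refine Finset.sum_eq_zero fun i hi ↦ ?_
    rcases le_or_gt k i with hik | hik
    · obtain ⟨r, rfl⟩ := Nat.exists_eq_add_of_le hik
      rw [add_comm k r, pow_add, Module.End.mul_apply, h0, map_zero, TensorProduct.zero_tmul, smul_zero]
    · rw [hkill (k + d - i) (by omega), TensorProduct.tmul_zero, smul_zero]
  have hmem : x ⊗ₜ[K] n₀ ∈ degreeSpace (h.rTensor N + h'.lTensor M) (-((k + d : ℕ) : ℤ)) := by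
    have h1 := tmul_mem_degreeSpace (h := h) (h' := h') hx hn₀
    have h2 : (-(k : ℤ) + -(depth h' : ℤ)) = -((k + d : ℕ) : ℤ) := by rw [← hd]; push_cast; ring
    rwa [h2] at h1
  have hv : x ⊗ₜ[K] n₀ = 0 :=
    LT.eq_zero_of_pow_apply_eq_zero (n := ((k + d : ℕ) : ℤ)) (by omega) hmem (by rw [Int.toNat_natCast]; exact hE)
  exact eq_zero_of_tmul_eq_zero hn₀0 hv

/-! ### Surjectivity of `e^k : M_{-k} → M_k` -/

/-- A functional on a `ℤ`-graded space which is `1` on a given non-zero `n₁ ∈ N_d` and `0` on every `N_j`, `j ≠ d`.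
[cite: LooijengaLunts1997, §1 (1.1) p. 3 L106–L111 ("a ℤ-graded K-vector space")] -/
theorem exists_dual_eq_one_vanishing (hgr' : IsZGrading h') {d : ℤ} {n₁ : N} (hn₁ : n₁ ∈ degreeSpace h' d)
    (hn₁0 : n₁ ≠ 0) :
    ∃ φ : Module.Dual K N, φ n₁ = 1 ∧ ∀ (j : ℤ), j ≠ d → ∀ n ∈ degreeSpace h' j, φ n = 0 := by
  set T : Submodule K N := ⨆ (j : ℤ) (_ : j ≠ d), degreeSpace h' j with hT
  have hdis : Disjoint (degreeSpace h' d) T := by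
    have := (HasLefschetzProperty.isInternal_degreeSpace hgr').submodule_iSupIndep.disjoint_biSup (y := {j | j ≠ d}) (x := d) (by simp)
    simpa [hT] using this
  have hnot : n₁ ∉ T := fun hT1 ↦ hn₁0 ((Submodule.disjoint_def.1 hdis) n₁ hn₁ hT1)
  obtain ⟨f, hf, hfT⟩ := Submodule.exists_dual_map_eq_bot_of_notMem hnot inferInstance
  refine ⟨(f n₁)⁻¹ • f, by simp [hf], fun j hj n hn ↦ ?_⟩
  have h1 : f n ∈ T.map f := Submodule.mem_map_of_mem (Submodule.mem_iSup_of_mem j (Submodule.mem_iSup_of_mem hj hn))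
  rw [hfT, Submodule.mem_bot] at h1
  simp [h1]

omit [FiniteDimensional K M] in
/-- **Surjectivity.**  Under the same hypotheses (and `e` of degree `2`), `e^k : M_{-k} → M_k` is onto: test against a top vector
`0 ≠ n₁ ∈ N_d` and contract with a functional `φ` supported on `N_d`. [cite: LooijengaLunts1997, §1 (1.1) p. 4 L1–L2, L62–L63] -/
theorem HasLefschetzProperty.surjOn_of_tensor [Nontrivial N] (hgr : IsZGrading h) (hgr' : IsZGrading h')
    (he : ∀ k : ℤ, MapsTo e (degreeSpace h k) (degreeSpace h (k + 2))) (L' : HasLefschetzProperty h' e')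
    (LT : HasLefschetzProperty (h.rTensor N + h'.lTensor M) (e.rTensor N + e'.lTensor M)) (k : ℕ) {y : M}
    (hy : y ∈ degreeSpace h (k : ℤ)) : ∃ x ∈ degreeSpace h (-(k : ℤ)), (e ^ k) x = y := by
  set d := depth h' with hd
  -- a top vector `n₁ ∈ N_d` and a functional supported on `N_d`
  have hNd : degreeSpace h' (d : ℤ) ≠ ⊥ := by
    intro hbot
    apply L'.degreeSpace_neg_depth_ne_bot hgr'
    rw [Submodule.eq_bot_iff]
    intro n hn
    refine L'.eq_zero_of_pow_apply_eq_zero (n := (d : ℤ)) (by omega) (by rwa [← hd] at hn) ?_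
    have h1 : (e' ^ (d : ℤ).toNat) n ∈ degreeSpace h' (d : ℤ) :=
      (L'.bijOn_int (by omega : (0 : ℤ) ≤ d)).mapsTo (by rwa [← hd] at hn)
    rw [hbot, Submodule.mem_bot] at h1
    exact h1
  obtain ⟨n₁, hn₁, hn₁0⟩ := Submodule.exists_mem_ne_zero_of_ne_bot hNd
  obtain ⟨φ, hφ1, hφ0⟩ := exists_dual_eq_one_vanishing hgr' hn₁ hn₁0
  -- the contraction `Φ = id ⊗ φ`
  let Φ : M ⊗[K] N →ₗ[K] M := (TensorProduct.rid K M : M ⊗[K] K →ₗ[K] M) ∘ₗ φ.lTensor M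
  have hΦ : ∀ (x : M) (n : N), Φ (x ⊗ₜ[K] n) = φ n • x := fun x n ↦ by
    simp only [Φ, LinearMap.coe_comp, Function.comp_apply, LinearMap.lTensor_tmul, LinearEquiv.coe_coe,
      TensorProduct.rid_tmul]
  -- the target submodule `e^k M_{-k}`
  set T : Submodule K M := (degreeSpace h (-(k : ℤ))).map (e ^ k) with hT
  -- every generator `x ⊗ n`, `x ∈ M_a`, `n ∈ N_j`, `a + j = -(k+d)`, lands in `T` after `Φ ∘ E^{k+d}`
  have hgen : ∀ (a j : ℤ) (x : M) (n : N), a + j = -((k + d : ℕ) : ℤ) → x ∈ degreeSpace h a →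
      n ∈ degreeSpace h' j → Φ (((e.rTensor N + e'.lTensor M) ^ (k + d)) (x ⊗ₜ[K] n)) ∈ T := by
    intro a j x n haj hx hn
    rw [rTensor_add_lTensor_pow_tmul, map_sum]
    refine T.sum_mem fun i hi ↦ ?_
    rw [map_smul, hΦ]
    refine T.smul_mem _ ?_
    -- the degree of `e'^{k+d-i} n`
    have hdeg : (e' ^ (k + d - i)) n ∈ degreeSpace h' (j + 2 * ((k + d - i : ℕ) : ℤ)) :=
      pow_apply_mem_degreeSpace L'.mapsTo hn _
    by_cases hjd : j + 2 * ((k + d - i : ℕ) : ℤ) = d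
    · -- then `i ≥ k` (else `j < -d` and `n = 0`)
      rcases lt_or_ge i k with hik | hik
      · have hi' : i ≤ k + d := by
          have := Finset.mem_range.1 hi; omega
        have hjlt : j < -(d : ℤ) := by omega
        have hnbot : degreeSpace h' j = ⊥ := by
          have h2 : j = -(((-j).toNat : ℕ) : ℤ) := by omega
          rw [h2]
          exact L'.degreeSpace_neg_eq_bot_of_depth_lt (by rw [← hd]; omega)
        rw [hnbot, Submodule.mem_bot] at hn
        rw [hn, map_zero, map_zero, zero_smul]
        exact T.zero_mem
      · obtain ⟨r, rfl⟩ := Nat.exists_eq_add_of_le hik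
        have hr : r ≤ d := by have := Finset.mem_range.1 hi; omega
        have hz : (e ^ r) x ∈ degreeSpace h (-(k : ℤ)) := by
          have h1 := pow_apply_mem_degreeSpace he hx r
          have h3 : ((k + d - (k + r) : ℕ) : ℤ) = (d : ℤ) - r := by
            rw [Nat.cast_sub (by omega)]; push_cast; ring
          have h2 : a + 2 * (r : ℤ) = -(k : ℤ) := by rw [h3] at hjd; push_cast at haj; omega
          rwa [h2] at h1
        refine T.smul_mem _ ⟨(e ^ r) x, hz, ?_⟩
        rw [← Module.End.mul_apply, ← pow_add, add_comm]
    · rw [hφ0 _ hjd _ hdeg, zero_smul]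
      exact T.zero_mem
  -- hence the whole degree part `(M ⊗ N)_{-(k+d)}` does
  have hall : ∀ u ∈ degreeSpace (h.rTensor N + h'.lTensor M) (-((k + d : ℕ) : ℤ)),
      Φ (((e.rTensor N + e'.lTensor M) ^ (k + d)) u) ∈ T := by
    intro u hu
    have hu' := degreeSpace_rTensor_add_lTensor_le_span hgr hgr' _ hu
    refine Submodule.span_induction (p := fun u _ ↦ Φ (((e.rTensor N + e'.lTensor M) ^ (k + d)) u) ∈ T)
      ?_ (by simp) (fun u v _ _ hu hv ↦ by simpa [map_add] using T.add_mem hu hv)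
      (fun c u _ hu ↦ by simpa [map_smul] using T.smul_mem c hu) hu'
    rintro _ ⟨a, j, x, n, haj, hx, hn, rfl⟩
    exact hgen a j x n haj hx hn
  -- apply to `u` with `E^{k+d} u = y ⊗ n₁`
  have hyn : y ⊗ₜ[K] n₁ ∈ degreeSpace (h.rTensor N + h'.lTensor M) ((k + d : ℕ) : ℤ) := by
    have h1 := tmul_mem_degreeSpace (h := h) (h' := h') hy hn₁
    have h2 : ((k : ℤ) + (depth h' : ℤ)) = ((k + d : ℕ) : ℤ) := by rw [← hd]; push_cast; ring
    rwa [h2] at h1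
  obtain ⟨u, hu, hEu⟩ := (LT.bijOn (k + d)).surjOn hyn
  have h1 := hall u hu
  rw [show ((e.rTensor N + e'.lTensor M) ^ (k + d)) u = y ⊗ₜ[K] n₁ from hEu, hΦ, hφ1, one_smul] at h1
  obtain ⟨x, hx, hxy⟩ := h1
  exact ⟨x, hx, hxy⟩

/-! ### The theorem -/

omit [FiniteDimensional K M] in
/-- **A tensor factor of a Lefschetz module is a Lefschetz module.**  Let `(M, h)`, `(N, h')` be finite-dimensional
`ℤ`-graded spaces over a field of characteristic `0` (`N` finite-dimensional; `M` arbitrary), `e` of degree `2` on `M`, `e'` a Lefschetz operator on `N`,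
`N ≠ 0`.  If `e ⊗ 1 + 1 ⊗ e'` has the Lefschetz property on `(M ⊗ N, h ⊗ 1 + 1 ⊗ h')`, then `e` has the Lefschetz
property on `(M, h)`.  (Converse of `HasLefschetzProperty.tensor`; by (1.1) `e` then has an `𝔰𝔩₂`-partner,
`HasLefschetzProperty.isSl2Triple_dual`.) [cite: LooijengaLunts1997, §1 (1.1) p. 4 L1–L5, L62–L63, L70–L76]
[cite: CattaniElZeinGriffithsLe2014, App. A Def. A.2.5] -/
theorem HasLefschetzProperty.of_tensor [Nontrivial N] (hgr : IsZGrading h) (hgr' : IsZGrading h')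
    (he : ∀ k : ℤ, MapsTo e (degreeSpace h k) (degreeSpace h (k + 2))) (L' : HasLefschetzProperty h' e')
    (LT : HasLefschetzProperty (h.rTensor N + h'.lTensor M) (e.rTensor N + e'.lTensor M)) :
    HasLefschetzProperty h e := by
  refine ⟨he, fun k ↦ ⟨fun x hx ↦ ?_, fun x hx x' hx' hxx' ↦ ?_, fun y hy ↦ ?_⟩⟩
  · have h1 := pow_apply_mem_degreeSpace he hx k
    have h2 : (-(k : ℤ) + 2 * (k : ℤ)) = k := by ring
    rwa [h2] at h1
  · have hsub : x - x' ∈ degreeSpace h (-(k : ℤ)) := Submodule.sub_mem _ hx hx'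
    have h0 : (e ^ k) (x - x') = 0 := by rw [map_sub, hxx', sub_self]
    exact sub_eq_zero.1 (HasLefschetzProperty.injOn_of_tensor hgr' L' LT k hsub h0)
  · obtain ⟨x, hx, rfl⟩ := HasLefschetzProperty.surjOn_of_tensor hgr hgr' he L' LT k hy
    exact ⟨x, hx, rfl⟩

end Literature.Algebra.Lie

end
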